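import Mathlib
import HarnessLib
import Summits.CriticalPhenomena.PercolationContinuityZ3.Theorems.PercNearOneGluingNoHeavyLowerTailTwoCopyStripRailRung

/-!
# Strips (4-terminal pieces): the two end rungs of every planar strip are Rayleigh, coefficientwise in `q`

Helper file for crux `stmt-CriticalPhenomena-4575` (new-inequality factory `prim-ineq-gen-1`, gen 24); memo
`run/shared/lean/prim/prim-ineq-gen-1/FINDING-33-*.md`.  Infrastructure (`SVec4`, the three moves `rung4`/`pendU4`/`pendW4`, `base4`, `Orb4`,
`good4_of_orb4`) from `…TwoCopyStripRailRung.lean` (THEOREM AD0, gen 23).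

THIS FILE: the universal form `DD0 q X` = `P_{d,d'}(L + d + d')/q³`, the two-copy core (FINDING-24) of the graph obtained from the strip `L` by adding
a rung `d = u_Rw_R` at its right end and a rung `d' = u_Lw_L` at its left end, for the pair `(d, d')` (the `v_a^0 v_b^0` coefficient of the class
'two rungs flanking a gap of a cyclic strip', obtained from the v-expanded one-piece expansion `qt4.onepiece_spec('d','dp',{a:0,b:0})`, validated against
brute force in gen 24).  The eigen-seeded PLAIN tower (kit j180270) closes with the root ALONE: the three move expansions below are exact identities with
nonnegative polynomial multipliers (checked here by `ring`), hence `DD0 q X` lies in every positive cone containing `q` and the weights (`DD0_pos`);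
real form `stripDD0_allq_nonneg` (every `q ≥ 0`), graded form `stripDD0_coeff_nonneg` (every q-coefficient).  NOT formalised: the identification of
`DD0`/`Orb4` with the graph polynomials (finite bookkeeping; scripts `kit/towerq7/qt4.py`).  (This work, 2026-08-23.)
-/

namespace Summit.CriticalPhenomena.PercolationContinuityZ3.Theorems

namespace TwoCopyStrip

open TwoCopyLadderAllGrades

variable {R : Type*} [CommRing R]

/-- The universal two-copy core `P_{d,d'}/q³` of (strip `L`) `+ d + d'`, `d = u_Rw_R` a rung added at the right end, `d' = u_Lw_L` a rung added at the left end, for the pair `(d, d')` (52 monomials). [this work] -/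
def DD0 (q : R) (X : SVec4 R) : R :=
  X.t6 * X.t9 + X.t6 ^ 2 + X.t5 * X.t6 + X.t2 * X.t9 + X.t2 * X.t6 + X.t2 * X.t5 + X.t1 * X.t9 + X.t1 * X.t6 + X.t1 * X.t5 - X.t0 * X.t12 - X.t0 * X.t11 - X.t0 * X.t10 - X.t0 * X.t7 + X.t0 * X.t6 + q * X.t6 * X.t13 + q * X.t6 * X.t12 + q * X.t6 * X.t11 + q * X.t6 * X.t10 + q * X.t6 * X.t7 + q * X.t4 * X.t9 + q * X.t4 * X.t6 + q * X.t4 * X.t5 - q * X.t3 * X.t12 - q * X.t3 * X.t11 - q * X.t3 * X.t10 - q * X.t3 * X.t7 + q * X.t3 * X.t6 + q * X.t2 * X.t13 - q * X.t2 * X.t9 - q * X.t2 * X.t5 + q * X.t1 * X.t13 - q * X.t1 * X.t9 - q * X.t1 * X.t5 - q * X.t0 * X.t14 + q * X.t0 * X.t12 + q * X.t0 * X.t11 + q * X.t0 * X.t10 + q * X.t0 * X.t7 + q ^ 2 * X.t6 * X.t14 + q ^ 2 * X.t4 * X.t13 - q ^ 2 * X.t4 * X.t9 - q ^ 2 * X.t4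 * X.t5 - q ^ 2 * X.t3 * X.t14 + q ^ 2 * X.t3 * X.t12 + q ^ 2 * X.t3 * X.t11 + q ^ 2 * X.t3 * X.t10 + q ^ 2 * X.t3 * X.t7 - q ^ 2 * X.t2 * X.t13 - q ^ 2 * X.t1 * X.t13 + q ^ 2 * X.t0 * X.t14 - q ^ 3 * X.t4 * X.t13 + q ^ 3 * X.t3 * X.t14

/-- `DD0` under `pendU4`: the tower expansion (exact identity). [this work] -/
theorem DD0_pendU4 (q a : R) (X : SVec4 R) :
    DD0 q (pendU4 q a X) = a ^ 2 * DD0 q X + a * q * DD0 q X := by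
  unfold DD0 pendU4; ring

/-- `DD0` under `pendW4`: the tower expansion (exact identity). [this work] -/
theorem DD0_pendW4 (q b : R) (X : SVec4 R) :
    DD0 q (pendW4 q b X) = b ^ 2 * DD0 q X + b * q * DD0 q X := by
  unfold DD0 pendW4; ring

/-- `DD0` under `rung4`: the tower expansion (exact identity). [this work] -/
theorem DD0_rung4 (q t : R) (X : SVec4 R) :
    DD0 q (rung4 t X) = t * DD0 q X + DD0 q X := by
  unfold DD0 rung4; ring

/-! ## Positivity along the strip orbit -/

section Cone

variable {P : R → Prop}

/-- The invariant of this file: all certificate forms lie in the cone. [this work] -/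
structure GoodDD0 (P : R → Prop) (q : R) (X : SVec4 R) : Prop where
  /-- `DD0 ∈ P` -/
  h_DD0 : P (DD0 q X)

/-- `base4` is good. [this work] -/
theorem goodDD0_base (hP : IsPosCone P) {q : R} (_hq : P q) : GoodDD0 P q (base4 : SVec4 R) := by
  refine ⟨?_⟩
  · have e : DD0 q (base4 : SVec4 R) = 1 := by unfold DD0 base4; ring
    rw [e]; apply_rules (maxDepth := 3000) [hP.add, hP.mul, hP.pow, hP.zero, hP.one, hP.ofNat]

/-- `pendU4` preserves goodness (given the entries of `X` in the cone). [this work] -/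
theorem goodDD0_pendU4 (hP : IsPosCone P) {q a : R} (_hq : P q) (_hw : P a) {X : SVec4 R} (hE : Good4 P q X) (h : GoodDD0 P q X) :
    GoodDD0 P q (pendU4 q a X) := by
  obtain ⟨h0, h1, h2, h3, h4, h5, h6, h7, h9, h10, h11, h12, h13, h14, _⟩ := hE
  obtain ⟨h_DD0⟩ := h
  refine ⟨?_⟩
  · rw [DD0_pendU4]
    apply_rules (maxDepth := 3000) [hP.add, hP.mul, hP.pow, hP.zero, hP.one, hP.ofNat]

/-- `pendW4` preserves goodness (given the entries of `X` in the cone). [this work] -/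
theorem goodDD0_pendW4 (hP : IsPosCone P) {q b : R} (_hq : P q) (_hw : P b) {X : SVec4 R} (hE : Good4 P q X) (h : GoodDD0 P q X) :
    GoodDD0 P q (pendW4 q b X) := by
  obtain ⟨h0, h1, h2, h3, h4, h5, h6, h7, h9, h10, h11, h12, h13, h14, _⟩ := hE
  obtain ⟨h_DD0⟩ := h
  refine ⟨?_⟩
  · rw [DD0_pendW4]
    apply_rules (maxDepth := 3000) [hP.add, hP.mul, hP.pow, hP.zero, hP.one, hP.ofNat]

/-- `rung4` preserves goodness (given the entries of `X` in the cone). [this work] -/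
theorem goodDD0_rung4 (hP : IsPosCone P) {q t : R} (_hq : P q) (_hw : P t) {X : SVec4 R} (hE : Good4 P q X) (h : GoodDD0 P q X) :
    GoodDD0 P q (rung4 t X) := by
  obtain ⟨h0, h1, h2, h3, h4, h5, h6, h7, h9, h10, h11, h12, h13, h14, _⟩ := hE
  obtain ⟨h_DD0⟩ := h
  refine ⟨?_⟩
  · rw [DD0_rung4]
    apply_rules (maxDepth := 3000) [hP.add, hP.mul, hP.pow, hP.zero, hP.one, hP.ofNat]

/-- Every strip of the orbit is good for this file's forms. [this work] -/
theorem goodDD0_of_orb4 (hP : IsPosCone P) {q : R} (hq : P q) {X : SVec4 R} (hX : Orb4 P q X) : GoodDD0 P q X := by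
  induction hX with
  | base => exact goodDD0_base hP hq
  | rung ht hX ih => exact goodDD0_rung4 hP hq ht (good4_of_orb4 hP hq hX) ih
  | pendU ha hX ih => exact goodDD0_pendU4 hP hq ha (good4_of_orb4 hP hq hX) ih
  | pendW hb hX ih => exact goodDD0_pendW4 hP hq hb (good4_of_orb4 hP hq hX) ih

/-- THEOREM DD0 (cone form): The universal two-copy core `P_{d,d'}/q³` of (strip `L`) `+ d + d'`, `d = u_Rw_R` a rung added at the right end, `d' = u_Lw_L` a rung added at the left end, for the pair `(d, d')` lies in the cone for every strip of the orbit. [this work] -/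
theorem DD0_pos (hP : IsPosCone P) {q : R} (hq : P q) {X : SVec4 R} (hX : Orb4 P q X) : P (DD0 q X) :=
  (goodDD0_of_orb4 hP hq hX).h_DD0

end Cone

section Real

variable {S : Type*} [CommRing S] [LinearOrder S] [IsStrictOrderedRing S]

/-- THEOREM DD0, real form: for every real `q ≥ 0` and every strip grown with nonnegative weights, `DD0 q X ≥ 0` — for `0 < q < 1` this is Rayleigh negative correlation of the two end rungs `d = u_Rw_R`, `d' = u_Lw_L` added to any planar strip (via `(1−q)·P = q·Δ`). [this work] -/
theorem stripDD0_allq_nonneg {q : S} (hq : 0 ≤ q) {X : SVec4 S} (hX : Orb4 (fun x : S => 0 ≤ x) q X) : 0 ≤ DD0 q X :=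
  DD0_pos (P := fun x : S => 0 ≤ x) isPosCone_nonneg hq hX

end Real

section Graded

variable {S : Type*} [CommRing S] [LinearOrder S] [IsStrictOrderedRing S]

open Polynomial

/-- THEOREM DD0, graded form: with `q = X` and weights polynomials with nonnegative coefficients, every q-coefficient of `DD0` is `≥ 0`. [this work] -/
theorem stripDD0_coeff_nonneg {Y : SVec4 S[X]} (hY : Orb4 (fun p : S[X] => ∀ n, 0 ≤ p.coeff n) X Y) (n : ℕ) :
    0 ≤ (DD0 X Y).coeff n :=
  DD0_pos (P := fun p : S[X] => ∀ n, 0 ≤ p.coeff n) isPosCone_coeff (fun n => by rw [coeff_X]; split_ifs <;> norm_num) hY n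

end Graded

end TwoCopyStrip

end Summit.CriticalPhenomena.PercolationContinuityZ3.Theorems
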